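import Summits.QuantumFields.YangMills.Theorems.BalabanUVNodesN06StepL2AtPinsPhys
import Literature.MathematicalPhysics.QuantumFieldTheory.Balaban1983to89.B9BackgroundsKLevelV1R

/-!
# BalabanUVNodes ∕ N06 ([B9], `Dag.B9_main`) — THE L² STEP `hstepL2` OF THE STAGE-11 CERTIFICATE AT def-Y's CLASS-PARAMETRIC CARRIER `bg9YR 𝔸 G R₁ R₂`
# (CASCADE-R STEP 3 face of `…N06StepL2AtPinsPhys`: the regularity premises (3.35)–(3.36) are PARAMETERS `R₁ R₂ : RegFamY …`; `bg9Y` and print's class `bg9YP`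
# specialise by `rfl`), consumed by the class re-press of dag-n06-d's certificate (ED.39, form (α))

Track A of `YM-PLAN.md` (cell `pub-ymgap`, HUMAN RULING D-0062), node **N06** = [Balaban1985BackgroundPropagators] Thms 3.1–3.15; seat `pub-ymgap-dag-n06-w8` (g3), 2026-08-28.
WHY.  Edition 35 of the certificate (`…V6EPairNP` :330) consumes this lineage's `N06StepL2AtPinsPhys.stepL2_of_letter_schemas_residual` (g0, p612337), whose displayed
input binders `h31 h46 h49 hBJ hD2L2` and output are typed at MODULE 3's small-cube class `(bg9Y …).Reg335 c35Y α₀ U`.  node00-def-Y g22 RULING-W′ (pub-ymgap INBOX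
2026-08-28 11:58Z) + dag-n06-d g12 ANSWER-DEFY-STEP3 (12:09Z): the class of record becomes PRINT's class, re-press form (α) — objects stay over `bg9Y`, ONLY the premises
read `(bg9YP 𝔸 G x).Reg335 c35Y α₀ U`; a COMBINATOR whose inputs are displayed binders must therefore accept the re-pressed premises.  THIS FILE re-types the three
theorems of `…N06StepL2AtPinsPhys` ONCE at def-Y's class-parametric carrier (`B9BackgroundsKLevelV1R`): premises `(bg9YR (M_N(ℂ)) SU(N) R₁ R₂ x).Reg335 c α₀ U`
(`= R₁ x c α₀ U` by `Iff.rfl`), constant `c` FREE, objects (`𝔬12`, the coordinate models, `U : (bg9Y …).Cfg`) UNCHANGED (`bg9YR_Cfg_eq` rfl); the ONLY class fact the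
proofs read — «`U` is `SU(N)`-valued» (`hU.1.1` in the original) — enters as the class axiom `hG : MemOfFam SU(N) R₁` (`memOfFam_regY335` ∕ `memOfFam_regYP335`).  At
`R₁ := regY335`, `R₂ := regY336`, `c := c35Y` the statements ARE the originals (`bg9Y_eq_bg9YR` rfl); at `R₁ := regYP335`, `R₂ := regYP336` they are the STEP-3 faces
(`bg9YP_eq_bg9YR` rfl).  ★★ `blockBd_tpi_of_letter_schemasR`, ★★ `stepL2_of_letter_schemasR`, ★★ `stepL2_of_letter_schemas_residualR` — proofs VERBATIM those of the
original (Schur + [4] (2.54)∕(2.60)∕(2.61); the transpose facts are tree theorems at a unitary-valued `U`; `isTransposePair_BcoKH_BdcoKH` BY NAME from the original).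
HONEST FRAMING.  Kernel bookkeeping; COUNT-NEUTRAL; nothing of [B9] asserted — Theorem 3.1 (3.42)∕(3.46)₄, (3.49), (3.117) at `U ≠ 1` and the residual letter are
DISPLAYED hypotheses about the genuine operators; N06 NOT discharged; K1 NOT closed.  One finite 𝕋⁴ programme at fixed `ε` — NOT continuum, NOT OS, NOT the mass gap ∕
Clay.  0 `def`, 0 `sorry`.
-/

noncomputable section

namespace Summit.QuantumFields.YangMills.BalabanUVNodes.N06StepL2AtPinsPhysR

open Literature.MathematicalPhysics.QuantumFieldTheory.Balaban1983to89
open Literature.MathematicalPhysics.QuantumFieldTheory.Balaban1983to89.Node00 (CfgY GpY GpPhysY parSymY hessY_isSymmTr isAdjTr_comp isAdjTr_of_isSymmTr)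
open Literature.MathematicalPhysics.QuantumFieldTheory.Balaban1983to89.Node00.OpsYSectDCoords (DvcoKH DvscoKH RcoK TpicoK T2coK isTransposePair_DvcoKH_DvscoKH
  isTransposePair_RcoK isTransposePair_coordOpKH_trBasis)
open Literature.MathematicalPhysics.QuantumFieldTheory.Balaban1983to89.B9Thm34Ext (toB6)
open Literature.MathematicalPhysics.QuantumFieldTheory.Balaban1983to89.B11SectG (BlockNorm HasMaj RowSum)
open Literature.MathematicalPhysics.QuantumFieldTheory.Balaban1983to89.B9SectDL2Decay (BlockBd)
open Literature.MathematicalPhysics.QuantumFieldTheory.Balaban1983to89.B9Thm37Glue (IsTransposePair isTransposePair_one)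
open Literature.MathematicalPhysics.QuantumFieldTheory.Balaban1983to89.B9Thm312Whole (GeoOK)
open Literature.MathematicalPhysics.QuantumFieldTheory.Balaban1983to89.B9Thm312WholeL2 (StepL2)
open Literature.MathematicalPhysics.QuantumFieldTheory.Balaban1983to89.B9RWSums343to347Whole (Facts347)
open Literature.MathematicalPhysics.QuantumFieldTheory.Balaban1983to89.B9RWSumsDefinitePins (PinPrims)
open Literature.MathematicalPhysics.QuantumFieldTheory.Balaban1983to89.B9RWSums347DefiniteFaces (exp261 lemma21Pack_geo9Y)
open Literature.MathematicalPhysics.QuantumFieldTheory.Balaban1983to89.B9RowSum261DefiniteFaces (rowConst261 rowConst261_nonneg rowConst261_spec_of_rowSum261)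
open Literature.MathematicalPhysics.QuantumFieldTheory.Balaban1983to89.B9PinMembersKLevelV1 (MemberY geo9Y bg9Y)
open Literature.MathematicalPhysics.QuantumFieldTheory.Balaban1983to89.B9BackgroundsKLevelV1R (RegFamY bg9YR MemOfFam)
open Summit.QuantumFields.YangMills.BalabanUVNodes.N06StepL2AtPinsPhys (isTransposePair_BcoKH_BdcoKH)
open Literature.MathematicalPhysics.QuantumFieldTheory.Balaban1983to89.B9GeoLemma21KLevelV1 (geo9Y_len_pos geo9Y_dist_triangle geo9Y_dist_comm rowSum261_geo9Y)
open Literature.MathematicalPhysics.QuantumFieldTheory.Balaban1983to89.B9GeoNormsKLevelV1 (geo9K_dist_nonneg)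
open Literature.MathematicalPhysics.QuantumFieldTheory.Balaban1983to89.B7Prop2SpecialUnitary (specialUnitaryUnits specialUnitaryUnits_le_unitaryUnits)
open Literature.MathematicalPhysics.QuantumFieldTheory.Balaban1983to89.B9CoReadingCoords (XBK)
open Literature.MathematicalPhysics.QuantumFieldTheory.Balaban1983to89.B9CoReadingCoordsH (XHK)
open Literature.MathematicalPhysics.QuantumFieldTheory.Balaban1983to89.B9CoReadingCoordsS (XSK GcoS)
open Literature.MathematicalPhysics.QuantumFieldTheory.Balaban1983to89.B9CoReadingCoordsTranspose (TrIdx trBasis isTransposePair_GcoS_trBasis)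
open Literature.MathematicalPhysics.QuantumFieldTheory.Balaban1983to89.B9Thm39ReadingCoords (cR39)
open Literature.MathematicalPhysics.QuantumFieldTheory.Balaban1983to89.Node00.OpsYSectDCoords (cR39_trBasis_pos)
open Literature.MathematicalPhysics.QuantumFieldTheory.Balaban1983to89.B9PerturbationSplitAtLetters (TaLcoK TbLcoKH tpicoK_eq_splitL hessGradY divHessY)
open Literature.MathematicalPhysics.QuantumFieldTheory.Balaban1983to89.B9PerturbationMajorantAlgebra (Thm31GpMaj Proj349Maj CurrentMaj)
open Literature.MathematicalPhysics.QuantumFieldTheory.Balaban1983to89.B9PerturbationMajorantsAtLetters (BcoKH BdcoKH PcoK rcoK_eq)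
open Literature.MathematicalPhysics.QuantumFieldTheory.Balaban1983to89.B9PerturbationMajorantsAtLettersPhys (taLcoK_phys_eq_comp tbLcoKH_phys_eq_comp)
open Literature.MathematicalPhysics.QuantumFieldTheory.Balaban1983to89.B9PerturbationL2Algebra (Thm31GpL2Mixed)
open Literature.MathematicalPhysics.QuantumFieldTheory.Balaban1983to89.B9PerturbationL2Letters (constL2 constL2_nonneg blockBd_tpi_of_split stepL2_of_blockBd)
open Literature.MathematicalPhysics.QuantumFieldTheory.Balaban1983to89.B9PerturbationL2Delta2 (D2coK constL2Pi constL2Pi_nonneg blockBd_t2_of_residual t2coK_phys_eq_sandwich)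
open Literature.MathematicalPhysics.QuantumFieldTheory.Balaban1983to89.B9Thm311AdjointPairs (GpY_isSymmTr isAdjTr_gradY_divY)
open Literature.MathematicalPhysics.QuantumFieldTheory.Balaban1983to89.B9Thm311SymmAtRecordV4 (symm0_parSymY)
open scoped Matrix.Norms.L2Operator

variable {N : ℕ} [NeZero N]
variable {d ℓ : ℕ} {hd : 1 ≤ d + 1} {hL : Odd (ℓ + 1) ∧ 1 < ℓ + 1} {b₀ b₁ : ℝ} {Mstar : ℕ}
variable [∀ x : MemberY d ℓ hd hL b₀ b₁ Mstar, Fintype (geo9Y x).Site]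

/-- the kernel domination: `C·t_J·θ·w ≤ t·θ·w` for `C·t_J ≤ t`, `θ, w ≥ 0`. [cite: Balaban1985BackgroundPropagators, (3.131) p.422, bookkeeping] -/
private theorem kernel_dom {C tJ t θ u v e : ℝ} (hCt : C * tJ ≤ t) (hθ : 0 ≤ θ) (hu : 0 ≤ u) (hv : 0 ≤ v) (he : 0 ≤ e) :
    C * (tJ * θ) * u * v * e ≤ t * θ * u * v * e := by
  have h1 : C * (tJ * θ) ≤ t * θ := by rw [← mul_assoc]; exact mul_le_mul_of_nonneg_right hCt hθ
  exact mul_le_mul_of_nonneg_right (mul_le_mul_of_nonneg_right (mul_le_mul_of_nonneg_right h1 hu) hv) he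

/-- a transpose pair scaled on both sides by the same real is a transpose pair (def-Y's private lemma, re-proved). [folklore] -/
private theorem isTransposePair_smul_smul {X Y : Type} [Fintype X] [Fintype Y] {A : (X → ℝ) →ₗ[ℝ] (Y → ℝ)} {B : (Y → ℝ) →ₗ[ℝ] (X → ℝ)}
    (h : IsTransposePair A B) (r : ℝ) : IsTransposePair (r • A) (r • B) := by
  intro u v
  simp only [LinearMap.smul_apply, Pi.smul_apply, smul_eq_mul]
  calc ∑ y, r * A u y * v y = r * ∑ y, A u y * v y := by rw [Finset.mul_sum]; exact Finset.sum_congr rfl fun y _ => by ring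
    _ = r * ∑ x, u x * B v x := by rw [h u v]
    _ = ∑ x, u x * (r * B v x) := by rw [Finset.mul_sum]; exact Finset.sum_congr rfl fun x _ => by ring

/-- ★★ **THE BLOCK-L² BOUND OF Δ′_π AT THE PINS — `StepL2.t`'s SHAPE — FROM THE THREE SUP SCHEMAS, (3.46)₄ AND THE PIN** (module docstring).  Inputs as in
`split_majorants_of_letter_schemas` (`q hq H 𝔬12`, numerics, `h31 h49 hBJ`), plus `h46` ((3.46)₄ at `DvcoKH ∘ GcoS(GpY) ∘ DvscoKH`, block-L²), the pin `hTpico12`, `B₄ δ₄`,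
`r ≤ δ₄`, and ONE displayed constant `t2L ≥ constL2 … (ℓ+1) · t_J`.  Output: `∃ ML`, and for every member with `ML ≤ M_x` in the regime, the block bound of `(𝔬12 x).Tpi U`
with kernel `t2L·(M_xα₀)·(Lʲη)⁻¹·(L^{j′}η)⁻¹·e^{−δ_T d}`. [cite: Balaban1985BackgroundPropagators, (3.130)–(3.131) pp.421–422, (3.120) p.419, Thm 3.1 (3.42) p.397 + (3.46) p.398, (3.49) p.399, (3.117) p.419, p.391; Balaban1984PropagatorsII, (2.54), (2.60)–(2.61) pp.233–234] -/
theorem blockBd_tpi_of_letter_schemasR (q : PinPrims) (hq : q.OK) (H : MemberY d ℓ hd hL b₀ b₁ Mstar → Prop)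
    (R₁ R₂ : RegFamY d ℓ hd hL b₀ b₁ Mstar (Matrix (Fin N) (Fin N) ℂ)) (hG : MemOfFam (specialUnitaryUnits (Fin N)) R₁) (c : ℝ)
    (𝔬12 : ∀ x : MemberY d ℓ hd hL b₀ b₁ Mstar, B9Thm312Whole.Ops (geo9Y x) (bg9Y (Matrix (Fin N) (Fin N) ℂ) (specialUnitaryUnits (Fin N)) x)
      (XBK (TrIdx N) x.toKIdx) (XBK (TrIdx N) x.toKIdx) (XHK (TrIdx N) x.toKIdx) (XSK (TrIdx N) x.toKIdx))
    (B₀ δ₀ CP δP tJ δB B₄ δ₄ r δT σS t2L M a : ℝ) (hB₀ : 0 ≤ B₀) (hCP : 0 ≤ CP) (htJ : 0 ≤ tJ) (hB₄ : 0 ≤ B₄) (hσS : 0 < σS) (hM : 0 < M)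
    (hr₀ : r ≤ δ₀) (hrP : r ≤ δP) (hrB : r ≤ δB) (hr₄ : r ≤ δ₄) (hδT : 0 ≤ δT) (hδTr : δT + 2 * σS + 3 * (q.αF * ((1 - 2 * q.α) * q.δ₀)) ≤ r)
    (ht2L : constL2 (cR39 (trBasis N))⁻¹ B₀ CP B₄
      (rowConst261 (geo9Y (d := d) (ℓ := ℓ) (hd := hd) (hL := hL) (b₀ := b₀) (b₁ := b₁) (Mstar := Mstar)) σS) ((ℓ + 1 : ℕ) : ℝ) * tJ ≤ t2L)
    (hTpico12 : ∀ (x : MemberY d ℓ hd hL b₀ b₁ Mstar) (U : (bg9Y (Matrix (Fin N) (Fin N) ℂ) (specialUnitaryUnits (Fin N)) x).Cfg), (𝔬12 x).Tpi U =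
      TpicoK x.toKIdx (trBasis N) (bg9Y (Matrix (Fin N) (Fin N) ℂ) (specialUnitaryUnits (Fin N)) x) (fun U => U) (parSymY x.toKIdx)
        (GpPhysY x.toKIdx (parSymY x.toKIdx)) U)
    (h31 : ∀ x : MemberY d ℓ hd hL b₀ b₁ Mstar, M ≤ (geo9Y x).M → ∀ α₀ : ℝ, 0 < α₀ → (geo9Y x).M * α₀ ≤ a →
      ∀ U : (bg9Y (Matrix (Fin N) (Fin N) ℂ) (specialUnitaryUnits (Fin N)) x).Cfg,
        (bg9YR (Matrix (Fin N) (Fin N) ℂ) (specialUnitaryUnits (Fin N)) R₁ R₂ x).Reg335 c α₀ U →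
        (bg9YR (Matrix (Fin N) (Fin N) ℂ) (specialUnitaryUnits (Fin N)) R₁ R₂ x).Reg336 c α₀ U →
          Thm31GpMaj (𝔬12 x).blkW (𝔬12 x).blk
            (GcoS x.toKIdx (trBasis N) (bg9Y (Matrix (Fin N) (Fin N) ℂ) (specialUnitaryUnits (Fin N)) x) (fun U => U) (GpY x.toKIdx (parSymY x.toKIdx)) U)
            (DvcoKH x.toKIdx (trBasis N) (bg9Y (Matrix (Fin N) (Fin N) ℂ) (specialUnitaryUnits (Fin N)) x) (fun U => U) U)
            (DvscoKH x.toKIdx (trBasis N) (bg9Y (Matrix (Fin N) (Fin N) ℂ) (specialUnitaryUnits (Fin N)) x) (fun U => U) U) 1 (H x) B₀ δ₀)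
    (h46 : ∀ x : MemberY d ℓ hd hL b₀ b₁ Mstar, M ≤ (geo9Y x).M → ∀ α₀ : ℝ, 0 < α₀ → (geo9Y x).M * α₀ ≤ a →
      ∀ U : (bg9Y (Matrix (Fin N) (Fin N) ℂ) (specialUnitaryUnits (Fin N)) x).Cfg,
        (bg9YR (Matrix (Fin N) (Fin N) ℂ) (specialUnitaryUnits (Fin N)) R₁ R₂ x).Reg335 c α₀ U →
        (bg9YR (Matrix (Fin N) (Fin N) ℂ) (specialUnitaryUnits (Fin N)) R₁ R₂ x).Reg336 c α₀ U →
          BlockBd (g := toB6 (geo9Y x) 1 (H x)) (𝔬12 x).blk (𝔬12 x).blk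
            (DvcoKH x.toKIdx (trBasis N) (bg9Y (Matrix (Fin N) (Fin N) ℂ) (specialUnitaryUnits (Fin N)) x) (fun U => U) U ∘ₗ
              GcoS x.toKIdx (trBasis N) (bg9Y (Matrix (Fin N) (Fin N) ℂ) (specialUnitaryUnits (Fin N)) x) (fun U => U) (GpY x.toKIdx (parSymY x.toKIdx)) U ∘ₗ
              DvscoKH x.toKIdx (trBasis N) (bg9Y (Matrix (Fin N) (Fin N) ℂ) (specialUnitaryUnits (Fin N)) x) (fun U => U) U)
            (fun (y y' : (geo9Y x).Site) => B₄ * Real.exp (-(δ₄ * (geo9Y x).dist y y'))))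
    (h49 : ∀ x : MemberY d ℓ hd hL b₀ b₁ Mstar, M ≤ (geo9Y x).M → ∀ α₀ : ℝ, 0 < α₀ → (geo9Y x).M * α₀ ≤ a →
      ∀ U : (bg9Y (Matrix (Fin N) (Fin N) ℂ) (specialUnitaryUnits (Fin N)) x).Cfg,
        (bg9YR (Matrix (Fin N) (Fin N) ℂ) (specialUnitaryUnits (Fin N)) R₁ R₂ x).Reg335 c α₀ U →
        (bg9YR (Matrix (Fin N) (Fin N) ℂ) (specialUnitaryUnits (Fin N)) R₁ R₂ x).Reg336 c α₀ U →
          Proj349Maj (𝔬12 x).blkW (𝔬12 x).blk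
            (PcoK x.toKIdx (trBasis N) (bg9Y (Matrix (Fin N) (Fin N) ℂ) (specialUnitaryUnits (Fin N)) x) (fun U => U) (parSymY x.toKIdx)
              (GpY x.toKIdx (parSymY x.toKIdx)) U)
            (DvcoKH x.toKIdx (trBasis N) (bg9Y (Matrix (Fin N) (Fin N) ℂ) (specialUnitaryUnits (Fin N)) x) (fun U => U) U)
            (DvscoKH x.toKIdx (trBasis N) (bg9Y (Matrix (Fin N) (Fin N) ℂ) (specialUnitaryUnits (Fin N)) x) (fun U => U) U) 1 (H x) CP δP)
    (hBJ : ∀ x : MemberY d ℓ hd hL b₀ b₁ Mstar, M ≤ (geo9Y x).M → ∀ α₀ : ℝ, 0 < α₀ → (geo9Y x).M * α₀ ≤ a →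
      ∀ U : (bg9Y (Matrix (Fin N) (Fin N) ℂ) (specialUnitaryUnits (Fin N)) x).Cfg,
        (bg9YR (Matrix (Fin N) (Fin N) ℂ) (specialUnitaryUnits (Fin N)) R₁ R₂ x).Reg335 c α₀ U →
        (bg9YR (Matrix (Fin N) (Fin N) ℂ) (specialUnitaryUnits (Fin N)) R₁ R₂ x).Reg336 c α₀ U →
          CurrentMaj (𝔬12 x).blkW (𝔬12 x).blk
            (BcoKH x.toKIdx (trBasis N) (bg9Y (Matrix (Fin N) (Fin N) ℂ) (specialUnitaryUnits (Fin N)) x) (fun U => U) U)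
            (BdcoKH x.toKIdx (trBasis N) (bg9Y (Matrix (Fin N) (Fin N) ℂ) (specialUnitaryUnits (Fin N)) x) (fun U => U) U) 1 (H x)
            (tJ * ((geo9Y x).M * α₀)) δB) :
    ∃ ML : ℝ, ∀ x : MemberY d ℓ hd hL b₀ b₁ Mstar, ML ≤ (geo9Y x).M → M ≤ (geo9Y x).M → ∀ α₀ : ℝ, 0 < α₀ → (geo9Y x).M * α₀ ≤ a →
      ∀ U : (bg9Y (Matrix (Fin N) (Fin N) ℂ) (specialUnitaryUnits (Fin N)) x).Cfg,
        (bg9YR (Matrix (Fin N) (Fin N) ℂ) (specialUnitaryUnits (Fin N)) R₁ R₂ x).Reg335 c α₀ U →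
        (bg9YR (Matrix (Fin N) (Fin N) ℂ) (specialUnitaryUnits (Fin N)) R₁ R₂ x).Reg336 c α₀ U →
          BlockBd (g := toB6 (geo9Y x) 1 (H x)) (𝔬12 x).blk (𝔬12 x).blk ((𝔬12 x).Tpi U)
            (fun (y y' : (geo9Y x).Site) => t2L * ((geo9Y x).M * α₀) * ((geo9Y x).len y)⁻¹ * ((geo9Y x).len y')⁻¹ *
              Real.exp (-(δT * (geo9Y x).dist y y'))) := by
  -- member facts at ((1 − 2α)δ₀, α_F) (n06-k) and [4] (2.61) at the rate σ_S with n06-i's DEFINITE constant, above ONE threshold each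
  obtain ⟨ML, -, hfacts, -⟩ :=
    lemma21Pack_geo9Y (d := d) (ℓ := ℓ) (hd := hd) (hL := hL) (b₀ := b₀) (b₁ := b₁) (Mstar := Mstar) H hq.α_pos hq.α_lt
      hq.δ₀_pos hq.αF_pos (by linarith only [hq.αF_lt])
  obtain ⟨MLσ, hrowc⟩ := rowConst261_spec_of_rowSum261
    (rowSum261_geo9Y (d := d) (ℓ := ℓ) (hd := hd) (hL := hL) (b₀ := b₀) (b₁ := b₁) (Mstar := Mstar)) hσS
  have hN : 0 < N := Nat.pos_of_ne_zero (NeZero.ne N)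
  have hc0 : 0 < cR39 (trBasis N) := cR39_trBasis_pos hN
  have hcσ : 0 ≤ rowConst261 (geo9Y (d := d) (ℓ := ℓ) (hd := hd) (hL := hL) (b₀ := b₀) (b₁ := b₁) (Mstar := Mstar)) σS :=
    rowConst261_nonneg _ _
  have hτ : 0 ≤ q.αF * ((1 - 2 * q.α) * q.δ₀) :=
    mul_nonneg hq.αF_pos.le (mul_nonneg (by linarith only [hq.α_lt]) hq.δ₀_pos.le)
  refine ⟨max ML MLσ, fun x hMx hMM α₀ hα ha U hU hU' => ?_⟩
  have hgeo : GeoOK (geo9Y x) := ⟨geo9Y_dist_triangle x, geo9Y_dist_comm x, geo9K_dist_nonneg x.toKIdx, geo9Y_len_pos x⟩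
  have hF := hfacts x ((le_max_left _ _).trans hMx)
  have hrow : RowSum (toB6 (geo9Y x) 1 (H x)) σS
      (rowConst261 (geo9Y (d := d) (ℓ := ℓ) (hd := hd) (hL := hL) (b₀ := b₀) (b₁ := b₁) (Mstar := Mstar)) σS) :=
    fun y => hrowc x ((le_max_right _ _).trans hMx) y
  have hθ : 0 ≤ (geo9Y x).M * α₀ := mul_nonneg (hM.le.trans hMM) hα.le
  -- the transpose facts at the trace basis (tree theorems; `U` is special-unitary by (3.35))
  have hUu : ∀ μ z, ((U μ z : (Matrix (Fin N) (Fin N) ℂ)ˣ) : Matrix (Fin N) (Fin N) ℂ) ∈ unitary (Matrix (Fin N) (Fin N) ℂ) :=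
    fun μ z => specialUnitaryUnits_le_unitaryUnits (hG x c α₀ U hU μ z)
  have hGsym := isTransposePair_GcoS_trBasis x.toKIdx (bg9Y (Matrix (Fin N) (Fin N) ℂ) (specialUnitaryUnits (Fin N)) x) (fun U => U)
    (GpY x.toKIdx (parSymY x.toKIdx)) U (GpY_isSymmTr x.toKIdx (parSymY x.toKIdx) U (symm0_parSymY x.toKIdx specialUnitaryUnits_le_unitaryUnits (hG x c α₀ U hU)))
  have hDv := isTransposePair_DvcoKH_DvscoKH x.toKIdx (bg9Y (Matrix (Fin N) (Fin N) ℂ) (specialUnitaryUnits (Fin N)) x) (fun U => U) U hUu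
  have hDG := hGsym.comp hDv
  have hRsym := isTransposePair_RcoK x.toKIdx (bg9Y (Matrix (Fin N) (Fin N) ℂ) (specialUnitaryUnits (Fin N)) x) (fun U => U) U
    specialUnitaryUnits_le_unitaryUnits (hG x c α₀ U hU)
  have hPeq : PcoK x.toKIdx (trBasis N) (bg9Y (Matrix (Fin N) (Fin N) ℂ) (specialUnitaryUnits (Fin N)) x) (fun U => U) (parSymY x.toKIdx)
      (GpY x.toKIdx (parSymY x.toKIdx)) U = 1 - (cR39 (trBasis N)) •
        RcoK x.toKIdx (trBasis N) (bg9Y (Matrix (Fin N) (Fin N) ℂ) (specialUnitaryUnits (Fin N)) x) (fun U => U) (parSymY x.toKIdx) (GpY x.toKIdx (parSymY x.toKIdx)) U := by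
    rw [rcoK_eq, smul_smul, mul_inv_cancel₀ hc0.ne', one_smul, Module.End.one_eq_id, sub_sub_cancel]
  have hPsym : IsTransposePair
      (PcoK x.toKIdx (trBasis N) (bg9Y (Matrix (Fin N) (Fin N) ℂ) (specialUnitaryUnits (Fin N)) x) (fun U => U) (parSymY x.toKIdx) (GpY x.toKIdx (parSymY x.toKIdx)) U)
      (PcoK x.toKIdx (trBasis N) (bg9Y (Matrix (Fin N) (Fin N) ℂ) (specialUnitaryUnits (Fin N)) x) (fun U => U) (parSymY x.toKIdx) (GpY x.toKIdx (parSymY x.toKIdx)) U) := by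
    rw [hPeq]; exact isTransposePair_one.sub (isTransposePair_smul_smul hRsym _)
  have hDP := hPsym.comp hDv
  have hBB := isTransposePair_BcoKH_BdcoKH x.toKIdx (bg9Y (Matrix (Fin N) (Fin N) ℂ) (specialUnitaryUnits (Fin N)) x) (fun U => U) U hUu
  -- the split and the two factorizations at the repaired pin
  have hsplit := (hTpico12 x U).trans (tpicoK_eq_splitL x.toKIdx (trBasis N) (bg9Y (Matrix (Fin N) (Fin N) ℂ) (specialUnitaryUnits (Fin N)) x) (fun U => U)
    (parSymY x.toKIdx) (GpPhysY x.toKIdx (parSymY x.toKIdx)) U)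
  have hmain := blockBd_tpi_of_split hgeo hF hrow (h31 x hMM α₀ hα ha U hU hU') ⟨h46 x hMM α₀ hα ha U hU hU'⟩ (h49 x hMM α₀ hα ha U hU hU')
    (hBJ x hMM α₀ hα ha U hU hU') hGsym hDG hDP hBB
    (rcoK_eq x.toKIdx (trBasis N) (bg9Y (Matrix (Fin N) (Fin N) ℂ) (specialUnitaryUnits (Fin N)) x) (fun U => U) (parSymY x.toKIdx) (GpY x.toKIdx (parSymY x.toKIdx)) U)
    hsplit (taLcoK_phys_eq_comp x.toKIdx (trBasis N) (bg9Y (Matrix (Fin N) (Fin N) ℂ) (specialUnitaryUnits (Fin N)) x) (fun U => U) (parSymY x.toKIdx) hc0.ne' U)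
    (tbLcoKH_phys_eq_comp x.toKIdx (trBasis N) (bg9Y (Matrix (Fin N) (Fin N) ℂ) (specialUnitaryUnits (Fin N)) x) (fun U => U) (parSymY x.toKIdx) hc0.ne' U)
    (inv_nonneg.mpr hc0.le) hB₀ hCP hB₄ (mul_nonneg htJ hθ) hcσ hσS.le hτ hr₀ hrP hrB hr₄ hδT hδTr
  refine hmain.mono fun y y' => ?_
  exact kernel_dom ht2L hθ (inv_nonneg.mpr (geo9Y_len_pos x y).le) (inv_nonneg.mpr (geo9Y_len_pos x y').le) (Real.exp_nonneg _)

/-- ★★ **THE DISPLAYED BINDER `hstepL2` FROM THE LETTER SCHEMAS AND ONE RESIDUAL L² LETTER** (module docstring): the inputs of `blockBd_tpi_of_letter_schemas` plus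
`hT2L2` — the block-L² bound `θ₂·(M_xα₀)·(Lʲη)⁻¹(L^{j′}η)⁻¹e^{−δ_T d}` of `(𝔬12 x).T2 U` (Δ⁽²⁾_π = π†Δ⁽²⁾π reads the certificate's FREE residual `(𝔯 x).Δ2`, so this letter stays
displayed — the L² twin of `hta₂ ∕ htb₂`, (3.137) in L²) — give, above ONE threshold `ML`, `StepL2 (𝔬12 x) 1 (H x) ((t2L + θ₂)·(M_xα₀)) δ_T U`: the certificate's `hstepL2`
with `θ2₁₂ := t2L + θ₂`, `δK12 := δ_T`. [cite: Balaban1985BackgroundPropagators, (3.130)–(3.131) pp.421–422, (3.135)–(3.138) pp.422–423, (3.46) p.398, Thm 3.1 (3.42) p.397, (3.49) p.399, (3.117) p.419; Balaban1984PropagatorsII, (2.54), (2.60)–(2.61) pp.233–234] -/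
theorem stepL2_of_letter_schemasR (q : PinPrims) (hq : q.OK) (H : MemberY d ℓ hd hL b₀ b₁ Mstar → Prop)
    (R₁ R₂ : RegFamY d ℓ hd hL b₀ b₁ Mstar (Matrix (Fin N) (Fin N) ℂ)) (hG : MemOfFam (specialUnitaryUnits (Fin N)) R₁) (c : ℝ)
    (𝔬12 : ∀ x : MemberY d ℓ hd hL b₀ b₁ Mstar, B9Thm312Whole.Ops (geo9Y x) (bg9Y (Matrix (Fin N) (Fin N) ℂ) (specialUnitaryUnits (Fin N)) x)
      (XBK (TrIdx N) x.toKIdx) (XBK (TrIdx N) x.toKIdx) (XHK (TrIdx N) x.toKIdx) (XSK (TrIdx N) x.toKIdx))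
    (B₀ δ₀ CP δP tJ δB B₄ δ₄ r δT σS t2L θ₂ M a : ℝ) (hB₀ : 0 ≤ B₀) (hCP : 0 ≤ CP) (htJ : 0 ≤ tJ) (hB₄ : 0 ≤ B₄) (hθ₂ : 0 ≤ θ₂) (hσS : 0 < σS)
    (hM : 0 < M) (hr₀ : r ≤ δ₀) (hrP : r ≤ δP) (hrB : r ≤ δB) (hr₄ : r ≤ δ₄) (hδT : 0 ≤ δT) (hδTr : δT + 2 * σS + 3 * (q.αF * ((1 - 2 * q.α) * q.δ₀)) ≤ r)
    (ht2L : constL2 (cR39 (trBasis N))⁻¹ B₀ CP B₄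
      (rowConst261 (geo9Y (d := d) (ℓ := ℓ) (hd := hd) (hL := hL) (b₀ := b₀) (b₁ := b₁) (Mstar := Mstar)) σS) ((ℓ + 1 : ℕ) : ℝ) * tJ ≤ t2L)
    (hTpico12 : ∀ (x : MemberY d ℓ hd hL b₀ b₁ Mstar) (U : (bg9Y (Matrix (Fin N) (Fin N) ℂ) (specialUnitaryUnits (Fin N)) x).Cfg), (𝔬12 x).Tpi U =
      TpicoK x.toKIdx (trBasis N) (bg9Y (Matrix (Fin N) (Fin N) ℂ) (specialUnitaryUnits (Fin N)) x) (fun U => U) (parSymY x.toKIdx)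
        (GpPhysY x.toKIdx (parSymY x.toKIdx)) U)
    (h31 : ∀ x : MemberY d ℓ hd hL b₀ b₁ Mstar, M ≤ (geo9Y x).M → ∀ α₀ : ℝ, 0 < α₀ → (geo9Y x).M * α₀ ≤ a →
      ∀ U : (bg9Y (Matrix (Fin N) (Fin N) ℂ) (specialUnitaryUnits (Fin N)) x).Cfg,
        (bg9YR (Matrix (Fin N) (Fin N) ℂ) (specialUnitaryUnits (Fin N)) R₁ R₂ x).Reg335 c α₀ U →
        (bg9YR (Matrix (Fin N) (Fin N) ℂ) (specialUnitaryUnits (Fin N)) R₁ R₂ x).Reg336 c α₀ U →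
          Thm31GpMaj (𝔬12 x).blkW (𝔬12 x).blk
            (GcoS x.toKIdx (trBasis N) (bg9Y (Matrix (Fin N) (Fin N) ℂ) (specialUnitaryUnits (Fin N)) x) (fun U => U) (GpY x.toKIdx (parSymY x.toKIdx)) U)
            (DvcoKH x.toKIdx (trBasis N) (bg9Y (Matrix (Fin N) (Fin N) ℂ) (specialUnitaryUnits (Fin N)) x) (fun U => U) U)
            (DvscoKH x.toKIdx (trBasis N) (bg9Y (Matrix (Fin N) (Fin N) ℂ) (specialUnitaryUnits (Fin N)) x) (fun U => U) U) 1 (H x) B₀ δ₀)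
    (h46 : ∀ x : MemberY d ℓ hd hL b₀ b₁ Mstar, M ≤ (geo9Y x).M → ∀ α₀ : ℝ, 0 < α₀ → (geo9Y x).M * α₀ ≤ a →
      ∀ U : (bg9Y (Matrix (Fin N) (Fin N) ℂ) (specialUnitaryUnits (Fin N)) x).Cfg,
        (bg9YR (Matrix (Fin N) (Fin N) ℂ) (specialUnitaryUnits (Fin N)) R₁ R₂ x).Reg335 c α₀ U →
        (bg9YR (Matrix (Fin N) (Fin N) ℂ) (specialUnitaryUnits (Fin N)) R₁ R₂ x).Reg336 c α₀ U →
          BlockBd (g := toB6 (geo9Y x) 1 (H x)) (𝔬12 x).blk (𝔬12 x).blk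
            (DvcoKH x.toKIdx (trBasis N) (bg9Y (Matrix (Fin N) (Fin N) ℂ) (specialUnitaryUnits (Fin N)) x) (fun U => U) U ∘ₗ
              GcoS x.toKIdx (trBasis N) (bg9Y (Matrix (Fin N) (Fin N) ℂ) (specialUnitaryUnits (Fin N)) x) (fun U => U) (GpY x.toKIdx (parSymY x.toKIdx)) U ∘ₗ
              DvscoKH x.toKIdx (trBasis N) (bg9Y (Matrix (Fin N) (Fin N) ℂ) (specialUnitaryUnits (Fin N)) x) (fun U => U) U)
            (fun (y y' : (geo9Y x).Site) => B₄ * Real.exp (-(δ₄ * (geo9Y x).dist y y'))))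
    (h49 : ∀ x : MemberY d ℓ hd hL b₀ b₁ Mstar, M ≤ (geo9Y x).M → ∀ α₀ : ℝ, 0 < α₀ → (geo9Y x).M * α₀ ≤ a →
      ∀ U : (bg9Y (Matrix (Fin N) (Fin N) ℂ) (specialUnitaryUnits (Fin N)) x).Cfg,
        (bg9YR (Matrix (Fin N) (Fin N) ℂ) (specialUnitaryUnits (Fin N)) R₁ R₂ x).Reg335 c α₀ U →
        (bg9YR (Matrix (Fin N) (Fin N) ℂ) (specialUnitaryUnits (Fin N)) R₁ R₂ x).Reg336 c α₀ U →
          Proj349Maj (𝔬12 x).blkW (𝔬12 x).blk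
            (PcoK x.toKIdx (trBasis N) (bg9Y (Matrix (Fin N) (Fin N) ℂ) (specialUnitaryUnits (Fin N)) x) (fun U => U) (parSymY x.toKIdx)
              (GpY x.toKIdx (parSymY x.toKIdx)) U)
            (DvcoKH x.toKIdx (trBasis N) (bg9Y (Matrix (Fin N) (Fin N) ℂ) (specialUnitaryUnits (Fin N)) x) (fun U => U) U)
            (DvscoKH x.toKIdx (trBasis N) (bg9Y (Matrix (Fin N) (Fin N) ℂ) (specialUnitaryUnits (Fin N)) x) (fun U => U) U) 1 (H x) CP δP)
    (hBJ : ∀ x : MemberY d ℓ hd hL b₀ b₁ Mstar, M ≤ (geo9Y x).M → ∀ α₀ : ℝ, 0 < α₀ → (geo9Y x).M * α₀ ≤ a →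
      ∀ U : (bg9Y (Matrix (Fin N) (Fin N) ℂ) (specialUnitaryUnits (Fin N)) x).Cfg,
        (bg9YR (Matrix (Fin N) (Fin N) ℂ) (specialUnitaryUnits (Fin N)) R₁ R₂ x).Reg335 c α₀ U →
        (bg9YR (Matrix (Fin N) (Fin N) ℂ) (specialUnitaryUnits (Fin N)) R₁ R₂ x).Reg336 c α₀ U →
          CurrentMaj (𝔬12 x).blkW (𝔬12 x).blk
            (BcoKH x.toKIdx (trBasis N) (bg9Y (Matrix (Fin N) (Fin N) ℂ) (specialUnitaryUnits (Fin N)) x) (fun U => U) U)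
            (BdcoKH x.toKIdx (trBasis N) (bg9Y (Matrix (Fin N) (Fin N) ℂ) (specialUnitaryUnits (Fin N)) x) (fun U => U) U) 1 (H x)
            (tJ * ((geo9Y x).M * α₀)) δB)
    (hT2L2 : ∀ x : MemberY d ℓ hd hL b₀ b₁ Mstar, M ≤ (geo9Y x).M → ∀ α₀ : ℝ, 0 < α₀ → (geo9Y x).M * α₀ ≤ a →
      ∀ U : (bg9Y (Matrix (Fin N) (Fin N) ℂ) (specialUnitaryUnits (Fin N)) x).Cfg,
        (bg9YR (Matrix (Fin N) (Fin N) ℂ) (specialUnitaryUnits (Fin N)) R₁ R₂ x).Reg335 c α₀ U →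
        (bg9YR (Matrix (Fin N) (Fin N) ℂ) (specialUnitaryUnits (Fin N)) R₁ R₂ x).Reg336 c α₀ U →
          BlockBd (g := toB6 (geo9Y x) 1 (H x)) (𝔬12 x).blk (𝔬12 x).blk ((𝔬12 x).T2 U)
            (fun (y y' : (geo9Y x).Site) => θ₂ * ((geo9Y x).M * α₀) * ((geo9Y x).len y)⁻¹ * ((geo9Y x).len y')⁻¹ *
              Real.exp (-(δT * (geo9Y x).dist y y')))) :
    ∃ ML : ℝ, ∀ x : MemberY d ℓ hd hL b₀ b₁ Mstar, ML ≤ (geo9Y x).M → M ≤ (geo9Y x).M → ∀ α₀ : ℝ, 0 < α₀ → (geo9Y x).M * α₀ ≤ a →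
      ∀ U : (bg9Y (Matrix (Fin N) (Fin N) ℂ) (specialUnitaryUnits (Fin N)) x).Cfg,
        (bg9YR (Matrix (Fin N) (Fin N) ℂ) (specialUnitaryUnits (Fin N)) R₁ R₂ x).Reg335 c α₀ U →
        (bg9YR (Matrix (Fin N) (Fin N) ℂ) (specialUnitaryUnits (Fin N)) R₁ R₂ x).Reg336 c α₀ U →
          StepL2 (𝔬12 x) 1 (H x) ((t2L + θ₂) * ((geo9Y x).M * α₀)) δT U := by
  obtain ⟨ML, hML⟩ := blockBd_tpi_of_letter_schemasR q hq H R₁ R₂ hG c 𝔬12 B₀ δ₀ CP δP tJ δB B₄ δ₄ r δT σS t2L M a hB₀ hCP htJ hB₄ hσS hM hr₀ hrP hrB hr₄ hδT hδTr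
    ht2L hTpico12 h31 h46 h49 hBJ
  refine ⟨ML, fun x hMx hMM α₀ hα ha U hU hU' => ?_⟩
  have hgeo : GeoOK (geo9Y x) := ⟨geo9Y_dist_triangle x, geo9Y_dist_comm x, geo9K_dist_nonneg x.toKIdx, geo9Y_len_pos x⟩
  have hθ : 0 ≤ (geo9Y x).M * α₀ := mul_nonneg (hM.le.trans hMM) hα.le
  have h := stepL2_of_blockBd hgeo (mul_nonneg hθ₂ hθ) (hML x hMx hMM α₀ hα ha U hU hU') (hT2L2 x hMM α₀ hα ha U hU hU')
  rwa [← add_mul] at h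

/-- ★★ **v1.1 — THE DISPLAYED BINDER `hstepL2` WITH THE Δ⁽²⁾_π LETTER PUSHED DOWN TO THE RAW RESIDUAL** (module docstring, v1.1): the inputs of
`blockBd_tpi_of_letter_schemas` plus the certificate's pin `hT2co12` of `(𝔬12 x).T2` at a residual family `Δ2`, ONE displayed line `hD2L2` — the block-L² bound
`θ₂·(M_xα₀)·(Lʲη)⁻¹(L^{j′}η)⁻¹e^{−δ₂d}` of `D2coK … (Δ2 x) U` ((3.137) in L² for the FREE residual Δ⁽²⁾ itself) —, `r ≤ δ₂`, the budget `δ_T + 3σ_S + 3·α_F·((1−2α)δ₀) ≤ r`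
and a displayed constant `t2P ≥ θ₂·constL2Pi (cR39 (trBasis N))⁻¹ B₀ C_P B₄ (rowConst261 geo9Y σ_S) (ℓ+1)` give, above ONE threshold, `StepL2 (𝔬12 x) 1 (H x) ((t2L + t2P)·(M_xα₀)) δ_T U`.
[cite: Balaban1985BackgroundPropagators, (3.130)–(3.131) pp.421–422, (3.135) p.422, (3.137)–(3.138) p.423, (3.46) p.398, Thm 3.1 (3.42) p.397, (3.49) p.399, (3.117) p.419; Balaban1984PropagatorsII, (2.54), (2.60)–(2.61) pp.233–234] -/
theorem stepL2_of_letter_schemas_residualR (q : PinPrims) (hq : q.OK) (H : MemberY d ℓ hd hL b₀ b₁ Mstar → Prop)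
    (R₁ R₂ : RegFamY d ℓ hd hL b₀ b₁ Mstar (Matrix (Fin N) (Fin N) ℂ)) (hG : MemOfFam (specialUnitaryUnits (Fin N)) R₁) (c : ℝ)
    (𝔬12 : ∀ x : MemberY d ℓ hd hL b₀ b₁ Mstar, B9Thm312Whole.Ops (geo9Y x) (bg9Y (Matrix (Fin N) (Fin N) ℂ) (specialUnitaryUnits (Fin N)) x)
      (XBK (TrIdx N) x.toKIdx) (XBK (TrIdx N) x.toKIdx) (XHK (TrIdx N) x.toKIdx) (XSK (TrIdx N) x.toKIdx))
    (Δ2 : ∀ x : MemberY d ℓ hd hL b₀ b₁ Mstar, Node00.BondOpY (Matrix (Fin N) (Fin N) ℂ) x.toKIdx)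
    (B₀ δ₀ CP δP tJ δB B₄ δ₄ r δT σS t2L θ₂ δ₂ t2P M a : ℝ) (hB₀ : 0 ≤ B₀) (hCP : 0 ≤ CP) (htJ : 0 ≤ tJ) (hB₄ : 0 ≤ B₄) (hθ₂ : 0 ≤ θ₂)
    (hσS : 0 < σS) (hM : 0 < M) (hr₀ : r ≤ δ₀) (hrP : r ≤ δP) (hrB : r ≤ δB) (hr₄ : r ≤ δ₄) (hr₂ : r ≤ δ₂) (hδT : 0 ≤ δT)
    (hδTr : δT + 3 * σS + 3 * (q.αF * ((1 - 2 * q.α) * q.δ₀)) ≤ r)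
    (ht2L : constL2 (cR39 (trBasis N))⁻¹ B₀ CP B₄
      (rowConst261 (geo9Y (d := d) (ℓ := ℓ) (hd := hd) (hL := hL) (b₀ := b₀) (b₁ := b₁) (Mstar := Mstar)) σS) ((ℓ + 1 : ℕ) : ℝ) * tJ ≤ t2L)
    (ht2P : θ₂ * constL2Pi (cR39 (trBasis N))⁻¹ B₀ CP B₄
      (rowConst261 (geo9Y (d := d) (ℓ := ℓ) (hd := hd) (hL := hL) (b₀ := b₀) (b₁ := b₁) (Mstar := Mstar)) σS) ((ℓ + 1 : ℕ) : ℝ) ≤ t2P)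
    (hTpico12 : ∀ (x : MemberY d ℓ hd hL b₀ b₁ Mstar) (U : (bg9Y (Matrix (Fin N) (Fin N) ℂ) (specialUnitaryUnits (Fin N)) x).Cfg), (𝔬12 x).Tpi U =
      TpicoK x.toKIdx (trBasis N) (bg9Y (Matrix (Fin N) (Fin N) ℂ) (specialUnitaryUnits (Fin N)) x) (fun U => U) (parSymY x.toKIdx)
        (GpPhysY x.toKIdx (parSymY x.toKIdx)) U)
    (hT2co12 : ∀ (x : MemberY d ℓ hd hL b₀ b₁ Mstar) (U : (bg9Y (Matrix (Fin N) (Fin N) ℂ) (specialUnitaryUnits (Fin N)) x).Cfg), (𝔬12 x).T2 U =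
      T2coK x.toKIdx (trBasis N) (bg9Y (Matrix (Fin N) (Fin N) ℂ) (specialUnitaryUnits (Fin N)) x) (fun U => U) (parSymY x.toKIdx)
        (GpPhysY x.toKIdx (parSymY x.toKIdx)) (Δ2 x) U)
    (h31 : ∀ x : MemberY d ℓ hd hL b₀ b₁ Mstar, M ≤ (geo9Y x).M → ∀ α₀ : ℝ, 0 < α₀ → (geo9Y x).M * α₀ ≤ a →
      ∀ U : (bg9Y (Matrix (Fin N) (Fin N) ℂ) (specialUnitaryUnits (Fin N)) x).Cfg, (bg9YR (Matrix (Fin N) (Fin N) ℂ) (specialUnitaryUnits (Fin N)) R₁ R₂ x).Reg335 c α₀ U →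
        (bg9YR (Matrix (Fin N) (Fin N) ℂ) (specialUnitaryUnits (Fin N)) R₁ R₂ x).Reg336 c α₀ U →
          Thm31GpMaj (𝔬12 x).blkW (𝔬12 x).blk
            (GcoS x.toKIdx (trBasis N) (bg9Y (Matrix (Fin N) (Fin N) ℂ) (specialUnitaryUnits (Fin N)) x) (fun U => U) (GpY x.toKIdx (parSymY x.toKIdx)) U)
            (DvcoKH x.toKIdx (trBasis N) (bg9Y (Matrix (Fin N) (Fin N) ℂ) (specialUnitaryUnits (Fin N)) x) (fun U => U) U)
            (DvscoKH x.toKIdx (trBasis N) (bg9Y (Matrix (Fin N) (Fin N) ℂ) (specialUnitaryUnits (Fin N)) x) (fun U => U) U) 1 (H x) B₀ δ₀)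
    (h46 : ∀ x : MemberY d ℓ hd hL b₀ b₁ Mstar, M ≤ (geo9Y x).M → ∀ α₀ : ℝ, 0 < α₀ → (geo9Y x).M * α₀ ≤ a →
      ∀ U : (bg9Y (Matrix (Fin N) (Fin N) ℂ) (specialUnitaryUnits (Fin N)) x).Cfg, (bg9YR (Matrix (Fin N) (Fin N) ℂ) (specialUnitaryUnits (Fin N)) R₁ R₂ x).Reg335 c α₀ U →
        (bg9YR (Matrix (Fin N) (Fin N) ℂ) (specialUnitaryUnits (Fin N)) R₁ R₂ x).Reg336 c α₀ U →
          BlockBd (g := toB6 (geo9Y x) 1 (H x)) (𝔬12 x).blk (𝔬12 x).blk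
            (DvcoKH x.toKIdx (trBasis N) (bg9Y (Matrix (Fin N) (Fin N) ℂ) (specialUnitaryUnits (Fin N)) x) (fun U => U) U ∘ₗ
              GcoS x.toKIdx (trBasis N) (bg9Y (Matrix (Fin N) (Fin N) ℂ) (specialUnitaryUnits (Fin N)) x) (fun U => U) (GpY x.toKIdx (parSymY x.toKIdx)) U ∘ₗ
              DvscoKH x.toKIdx (trBasis N) (bg9Y (Matrix (Fin N) (Fin N) ℂ) (specialUnitaryUnits (Fin N)) x) (fun U => U) U)
            (fun (y y' : (geo9Y x).Site) => B₄ * Real.exp (-(δ₄ * (geo9Y x).dist y y'))))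
    (h49 : ∀ x : MemberY d ℓ hd hL b₀ b₁ Mstar, M ≤ (geo9Y x).M → ∀ α₀ : ℝ, 0 < α₀ → (geo9Y x).M * α₀ ≤ a →
      ∀ U : (bg9Y (Matrix (Fin N) (Fin N) ℂ) (specialUnitaryUnits (Fin N)) x).Cfg, (bg9YR (Matrix (Fin N) (Fin N) ℂ) (specialUnitaryUnits (Fin N)) R₁ R₂ x).Reg335 c α₀ U →
        (bg9YR (Matrix (Fin N) (Fin N) ℂ) (specialUnitaryUnits (Fin N)) R₁ R₂ x).Reg336 c α₀ U →
          Proj349Maj (𝔬12 x).blkW (𝔬12 x).blk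
            (PcoK x.toKIdx (trBasis N) (bg9Y (Matrix (Fin N) (Fin N) ℂ) (specialUnitaryUnits (Fin N)) x) (fun U => U) (parSymY x.toKIdx)
              (GpY x.toKIdx (parSymY x.toKIdx)) U)
            (DvcoKH x.toKIdx (trBasis N) (bg9Y (Matrix (Fin N) (Fin N) ℂ) (specialUnitaryUnits (Fin N)) x) (fun U => U) U)
            (DvscoKH x.toKIdx (trBasis N) (bg9Y (Matrix (Fin N) (Fin N) ℂ) (specialUnitaryUnits (Fin N)) x) (fun U => U) U) 1 (H x) CP δP)
    (hBJ : ∀ x : MemberY d ℓ hd hL b₀ b₁ Mstar, M ≤ (geo9Y x).M → ∀ α₀ : ℝ, 0 < α₀ → (geo9Y x).M * α₀ ≤ a →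
      ∀ U : (bg9Y (Matrix (Fin N) (Fin N) ℂ) (specialUnitaryUnits (Fin N)) x).Cfg, (bg9YR (Matrix (Fin N) (Fin N) ℂ) (specialUnitaryUnits (Fin N)) R₁ R₂ x).Reg335 c α₀ U →
        (bg9YR (Matrix (Fin N) (Fin N) ℂ) (specialUnitaryUnits (Fin N)) R₁ R₂ x).Reg336 c α₀ U →
          CurrentMaj (𝔬12 x).blkW (𝔬12 x).blk
            (BcoKH x.toKIdx (trBasis N) (bg9Y (Matrix (Fin N) (Fin N) ℂ) (specialUnitaryUnits (Fin N)) x) (fun U => U) U)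
            (BdcoKH x.toKIdx (trBasis N) (bg9Y (Matrix (Fin N) (Fin N) ℂ) (specialUnitaryUnits (Fin N)) x) (fun U => U) U) 1 (H x)
            (tJ * ((geo9Y x).M * α₀)) δB)
    (hD2L2 : ∀ x : MemberY d ℓ hd hL b₀ b₁ Mstar, M ≤ (geo9Y x).M → ∀ α₀ : ℝ, 0 < α₀ → (geo9Y x).M * α₀ ≤ a →
      ∀ U : (bg9Y (Matrix (Fin N) (Fin N) ℂ) (specialUnitaryUnits (Fin N)) x).Cfg, (bg9YR (Matrix (Fin N) (Fin N) ℂ) (specialUnitaryUnits (Fin N)) R₁ R₂ x).Reg335 c α₀ U →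
        (bg9YR (Matrix (Fin N) (Fin N) ℂ) (specialUnitaryUnits (Fin N)) R₁ R₂ x).Reg336 c α₀ U →
          BlockBd (g := toB6 (geo9Y x) 1 (H x)) (𝔬12 x).blk (𝔬12 x).blk
            (D2coK x.toKIdx (trBasis N) (bg9Y (Matrix (Fin N) (Fin N) ℂ) (specialUnitaryUnits (Fin N)) x) (fun U => U) (Δ2 x) U)
            (fun (y y' : (geo9Y x).Site) => θ₂ * ((geo9Y x).M * α₀) * ((geo9Y x).len y)⁻¹ * ((geo9Y x).len y')⁻¹ *
              Real.exp (-(δ₂ * (geo9Y x).dist y y')))) :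
    ∃ ML : ℝ, ∀ x : MemberY d ℓ hd hL b₀ b₁ Mstar, ML ≤ (geo9Y x).M → M ≤ (geo9Y x).M → ∀ α₀ : ℝ, 0 < α₀ → (geo9Y x).M * α₀ ≤ a →
      ∀ U : (bg9Y (Matrix (Fin N) (Fin N) ℂ) (specialUnitaryUnits (Fin N)) x).Cfg, (bg9YR (Matrix (Fin N) (Fin N) ℂ) (specialUnitaryUnits (Fin N)) R₁ R₂ x).Reg335 c α₀ U →
        (bg9YR (Matrix (Fin N) (Fin N) ℂ) (specialUnitaryUnits (Fin N)) R₁ R₂ x).Reg336 c α₀ U →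
          StepL2 (𝔬12 x) 1 (H x) ((t2L + t2P) * ((geo9Y x).M * α₀)) δT U := by
  have hδTr2 : δT + 2 * σS + 3 * (q.αF * ((1 - 2 * q.α) * q.δ₀)) ≤ r := by linarith
  obtain ⟨ML1, hML1⟩ := blockBd_tpi_of_letter_schemasR q hq H R₁ R₂ hG c 𝔬12 B₀ δ₀ CP δP tJ δB B₄ δ₄ r δT σS t2L M a hB₀ hCP htJ hB₄ hσS hM hr₀ hrP hrB hr₄ hδT
    hδTr2 ht2L hTpico12 h31 h46 h49 hBJ
  obtain ⟨ML2, -, hfacts, -⟩ :=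
    lemma21Pack_geo9Y (d := d) (ℓ := ℓ) (hd := hd) (hL := hL) (b₀ := b₀) (b₁ := b₁) (Mstar := Mstar) H hq.α_pos hq.α_lt
      hq.δ₀_pos hq.αF_pos (by linarith only [hq.αF_lt])
  obtain ⟨MLσ, hrowc⟩ := rowConst261_spec_of_rowSum261
    (rowSum261_geo9Y (d := d) (ℓ := ℓ) (hd := hd) (hL := hL) (b₀ := b₀) (b₁ := b₁) (Mstar := Mstar)) hσS
  have hc0 : 0 < cR39 (trBasis N) := cR39_trBasis_pos (Nat.pos_of_ne_zero (NeZero.ne N))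
  have hcσ : 0 ≤ rowConst261 (geo9Y (d := d) (ℓ := ℓ) (hd := hd) (hL := hL) (b₀ := b₀) (b₁ := b₁) (Mstar := Mstar)) σS := rowConst261_nonneg _ _
  have hτ : 0 ≤ q.αF * ((1 - 2 * q.α) * q.δ₀) := mul_nonneg hq.αF_pos.le (mul_nonneg (by linarith only [hq.α_lt]) hq.δ₀_pos.le)
  refine ⟨max ML1 (max ML2 MLσ), fun x hMx hMM α₀ hα ha U hU hU' => ?_⟩
  have hgeo : GeoOK (geo9Y x) := ⟨geo9Y_dist_triangle x, geo9Y_dist_comm x, geo9K_dist_nonneg x.toKIdx, geo9Y_len_pos x⟩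
  have hF := hfacts x ((le_max_left _ _).trans ((le_max_right _ _).trans hMx))
  have hrow : RowSum (toB6 (geo9Y x) 1 (H x)) σS
      (rowConst261 (geo9Y (d := d) (ℓ := ℓ) (hd := hd) (hL := hL) (b₀ := b₀) (b₁ := b₁) (Mstar := Mstar)) σS) :=
    fun y => hrowc x ((le_max_right _ _).trans ((le_max_right _ _).trans hMx)) y
  have hθ : 0 ≤ (geo9Y x).M * α₀ := mul_nonneg (hM.le.trans hMM) hα.le
  have hUu : ∀ μ z, ((U μ z : (Matrix (Fin N) (Fin N) ℂ)ˣ) : Matrix (Fin N) (Fin N) ℂ) ∈ unitary (Matrix (Fin N) (Fin N) ℂ) :=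
    fun μ z => specialUnitaryUnits_le_unitaryUnits (hG x c α₀ U hU μ z)
  have hGsym := isTransposePair_GcoS_trBasis x.toKIdx (bg9Y (Matrix (Fin N) (Fin N) ℂ) (specialUnitaryUnits (Fin N)) x) (fun U => U)
    (GpY x.toKIdx (parSymY x.toKIdx)) U (GpY_isSymmTr x.toKIdx (parSymY x.toKIdx) U (symm0_parSymY x.toKIdx specialUnitaryUnits_le_unitaryUnits (hG x c α₀ U hU)))
  have hDv := isTransposePair_DvcoKH_DvscoKH x.toKIdx (bg9Y (Matrix (Fin N) (Fin N) ℂ) (specialUnitaryUnits (Fin N)) x) (fun U => U) U hUu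
  have hRsym := isTransposePair_RcoK x.toKIdx (bg9Y (Matrix (Fin N) (Fin N) ℂ) (specialUnitaryUnits (Fin N)) x) (fun U => U) U specialUnitaryUnits_le_unitaryUnits (hG x c α₀ U hU)
  have hPeq : PcoK x.toKIdx (trBasis N) (bg9Y (Matrix (Fin N) (Fin N) ℂ) (specialUnitaryUnits (Fin N)) x) (fun U => U) (parSymY x.toKIdx)
      (GpY x.toKIdx (parSymY x.toKIdx)) U = 1 - (cR39 (trBasis N)) •
        RcoK x.toKIdx (trBasis N) (bg9Y (Matrix (Fin N) (Fin N) ℂ) (specialUnitaryUnits (Fin N)) x) (fun U => U) (parSymY x.toKIdx) (GpY x.toKIdx (parSymY x.toKIdx)) U := by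
    rw [rcoK_eq, smul_smul, mul_inv_cancel₀ hc0.ne', one_smul, Module.End.one_eq_id, sub_sub_cancel]
  have hPsym : IsTransposePair
      (PcoK x.toKIdx (trBasis N) (bg9Y (Matrix (Fin N) (Fin N) ℂ) (specialUnitaryUnits (Fin N)) x) (fun U => U) (parSymY x.toKIdx) (GpY x.toKIdx (parSymY x.toKIdx)) U)
      (PcoK x.toKIdx (trBasis N) (bg9Y (Matrix (Fin N) (Fin N) ℂ) (specialUnitaryUnits (Fin N)) x) (fun U => U) (parSymY x.toKIdx) (GpY x.toKIdx (parSymY x.toKIdx)) U) := by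
    rw [hPeq]; exact isTransposePair_one.sub (isTransposePair_smul_smul hRsym _)
  have hT2 := (hT2co12 x U).trans (t2coK_phys_eq_sandwich x.toKIdx (trBasis N) (bg9Y (Matrix (Fin N) (Fin N) ℂ) (specialUnitaryUnits (Fin N)) x) (fun U => U)
    (parSymY x.toKIdx) (Δ2 x) hc0.ne' U)
  have ht2 := blockBd_t2_of_residual hgeo hF hrow (h31 x hMM α₀ hα ha U hU hU') ⟨h46 x hMM α₀ hα ha U hU hU'⟩ (h49 x hMM α₀ hα ha U hU hU')
    (hGsym.comp hDv) (hPsym.comp hDv)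
    (rcoK_eq x.toKIdx (trBasis N) (bg9Y (Matrix (Fin N) (Fin N) ℂ) (specialUnitaryUnits (Fin N)) x) (fun U => U) (parSymY x.toKIdx) (GpY x.toKIdx (parSymY x.toKIdx)) U)
    (hD2L2 x hMM α₀ hα ha U hU hU') hT2 (inv_nonneg.mpr hc0.le) hB₀ hCP hB₄ (mul_nonneg hθ₂ hθ) hcσ hσS.le hτ hr₀ hrP hr₄ hr₂ hδT hδTr
  have ht2' : BlockBd (g := toB6 (geo9Y x) 1 (H x)) (𝔬12 x).blk (𝔬12 x).blk ((𝔬12 x).T2 U)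
      (fun (y y' : (geo9Y x).Site) => t2P * ((geo9Y x).M * α₀) * ((geo9Y x).len y)⁻¹ * ((geo9Y x).len y')⁻¹ * Real.exp (-(δT * (geo9Y x).dist y y'))) := by
    refine ht2.mono fun y y' => ?_
    have hK : θ₂ * ((geo9Y x).M * α₀) * constL2Pi (cR39 (trBasis N))⁻¹ B₀ CP B₄
        (rowConst261 (geo9Y (d := d) (ℓ := ℓ) (hd := hd) (hL := hL) (b₀ := b₀) (b₁ := b₁) (Mstar := Mstar)) σS) (geo9Y x).L ≤ t2P * ((geo9Y x).M * α₀) := by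
      calc θ₂ * ((geo9Y x).M * α₀) * constL2Pi (cR39 (trBasis N))⁻¹ B₀ CP B₄ (rowConst261 geo9Y σS) (geo9Y x).L
          = θ₂ * constL2Pi (cR39 (trBasis N))⁻¹ B₀ CP B₄ (rowConst261 geo9Y σS) (geo9Y x).L * ((geo9Y x).M * α₀) := by ring
        _ ≤ t2P * ((geo9Y x).M * α₀) := mul_le_mul_of_nonneg_right ht2P hθ
    exact mul_le_mul_of_nonneg_right (mul_le_mul_of_nonneg_right (mul_le_mul_of_nonneg_right hK (inv_nonneg.mpr (geo9Y_len_pos x y).le))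
      (inv_nonneg.mpr (geo9Y_len_pos x y').le)) (Real.exp_nonneg _)
  have h := stepL2_of_blockBd hgeo (mul_nonneg ((mul_nonneg hθ₂ (constL2Pi_nonneg _ _ _ _ _ _)).trans ht2P) hθ) (hML1 x ((le_max_left _ _).trans hMx) hMM α₀ hα ha U hU hU') ht2'
  rwa [← add_mul] at h

end Summit.QuantumFields.YangMills.BalabanUVNodes.N06StepL2AtPinsPhysR

end
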